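import Literature.AlgebraicGeometry.Motives.CartierDivisorProperIntersection
import Literature.AlgebraicGeometry.Motives.ChowDegree
import HarnessLib

/-!
# A curve meets a hypersurface not containing it in at most `deg` points (Fulton, Ex. 8.4.2 / 12.3)

[Fulton1998, Def. 2.3 (p. 33)] intersects a `k`-cycle `α` on `X` with a Cartier divisor `D`:
`D · α = Σ n_V [j_V^* D] ∈ Z_{k-1}` (the tree's honest cycle ★ `CartierDivisor.interCycle`, with
`D · [V] = ` ★ `CartierDivisor.primeInter`), and [Fulton1998, Def. 1.4 (p. 13)] takes degrees of
`0`-cycles on a complete scheme, `deg (Σ n_P [P]) = Σ n_P [κ(P) : K]` (★ `ChowGroup.degree`).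
For an EFFECTIVE Cartier divisor `D` (a hypersurface / hyperplane section) and an EFFECTIVE `1`-cycle
`γ` none of whose components lies in `|D|` (Fulton's «`D` meets `γ` properly»), the `0`-cycle `D · γ`
is effective and its coefficient at every closed point of `|γ| ∩ |D|` is `≥ 1` ([Fulton1998,
Prop. 7.1 (a)/Ex. 7.1.10: proper intersection multiplicities are positive]; here directly: the local
equation of `D` restricted to the component `V ∌ |D|` is a non-zero non-unit of the one-dimensional
local domain `𝒪_{V,P}`, so its order is `≥ 1`), whence the classical count
**`#(|γ| ∩ |D|)(closed points) ≤ deg (D · γ)`** — for a curve `C ⊂ 𝐏ⁿ` of degree `e` and a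
hyperplane `H ⊅ C`: `#(C ∩ H) ≤ e` ([Fulton1998, Example 8.4.2 / §12.3 Bézout]; [Hartshorne1977,
I Thm. 7.7 (p. 53)]).  Stated over an arbitrary ground field `K` (each closed point then weighs
`[κ(P) : K] ≥ 1`).

* `CartierDivisor.one_le_primeInter` — (L1) the local count on one component;
* `CartierDivisor.one_le_interCycle_apply` — (L2) the coefficient of `D · γ` at a closed point of `|γ| ∩ |D|` is `≥ 1`;
* `CartierDivisor.finite_support_of_mem_cyclesOfDim_zero` — a `0`-cycle on a proper `K`-scheme has finite support;
* `CartierDivisor.finite_and_ncard_le_degree_interCycle`, `CartierDivisor.card_le_degree_interCycle` — (C1) the count.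

PROOF lane, theorems only.  Cell hodgecm-mathlib, F-9 ROW 4a (9a-C1) (MFK Prop. 7.7's count of torsion
points on a hyperplane section, via ROW 4b `deg ([N]^*γ · D) = N^{2g-2} deg (γ · D)`); B-p04 (g20).

## Sources
* [Fulton1998] W. Fulton, *Intersection Theory*, 2nd ed., Springer (1998): Def. 1.4 (p. 13), Def. 2.3 (p. 33),
  Prop. 7.1 (p. 120), Example 8.4.2 (p. 146), §12.3.
* [Hartshorne1977] R. Hartshorne, *Algebraic Geometry*, GTM 52 (1977): I Thm. 7.7 (p. 53).
-/

noncomputable section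

universe u

open CategoryTheory AlgebraicGeometry Order Topology

namespace Literature.AlgebraicGeometry.Motives

namespace CartierDivisor

open RatFn

variable {K : Type u} [Field K] {X : SchemeOver K} [IsIntegral X.left]

section Local

variable [LocallyOfFiniteType X.hom]

/-- **(L1) The local count.** For an effective Cartier divisor `D`, a subvariety `V = closure {z} ⊄ |D|`
and a point `x ∈ V ∩ |D|` of codimension one in `V`, the coefficient of `[closure {x}]` in `D · [V]` is
`≥ 1`: it is the order at `x` of the restriction of a local equation of `D` to `V`, a non-zero
non-unit of the one-dimensional local domain `𝒪_{V,x}` (★ `IsEffective.ordAt_pos`).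
[cite: Fulton1998, Prop. 7.1 (a) (p. 120)] [cite: Fulton1998, Def. 2.3 (p. 33)] -/
theorem one_le_primeInter {D : CartierDivisor X.left} (hD : D.IsEffective) {z x : X.left}
    (hz : D.Avoids z) (hzx : z ⤳ x) (hx : ¬ D.Avoids x) (hcodim : height z = height x + 1) :
    1 ≤ D.primeInter z x := by
  classical
  simp only [Avoids, not_forall] at hx
  obtain ⟨i, hi, hu⟩ := hx
  set V := ClosedSubvariety.ofPoint X.left z with hV
  have hgen : D.Avoids (V.ι (genericPoint ↥V.carrier)) := by
    change D.Avoids V.genericPoint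
    rw [hV, ClosedSubvariety.genericPoint_ofPoint]
    exact hz
  rw [D.primeInter_apply_of_specializes hzx, D.pullbackRep_of_avoids _ hgen]
  set v : ↥V.carrier := ClosedSubvariety.ofPointPt z hzx with hv
  have hmem : V.ι (genericPoint ↥V.carrier) ∈ D.U i :=
    (V.ι.base.hom.map_specializes ((genericPoint_spec ↥V.carrier).specializes (Set.mem_univ v))).mem_open
      (D.U i).2 hi
  have hvi : v ∈ (D.pullbackAvoiding V.ι hgen).U ⟨i, hmem⟩ := hi
  -- `x` has codimension one in `V`
  have hcoh : coheight v = 1 := by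
    have hVv := Scheme.height_add_coheight_eq_height_top (V.over X.hom).hom v
    have htop : height (⊤ : ↥V.carrier) = height z := height_top_ofPoint z
    have hvx : height v = height x := by
      rw [← height_base_eq_of_isClosedImmersion' V.ι v]
      rfl
    change height v + coheight v = height (⊤ : ↥V.carrier) at hVv
    rw [htop, hcodim, hvx] at hVv
    obtain ⟨a, ha⟩ := ENat.ne_top_iff_exists.mp (height_ne_top_of_locallyOfFiniteType X.hom x)
    have hc : coheight v ≠ ⊤ := by
      intro h
      rw [h, ← ha] at hVv
      exact ENat.coe_ne_top (a + 1) (by simpa using hVv.symm)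
    obtain ⟨c, hc⟩ := ENat.ne_top_iff_exists.mp hc
    rw [← ha, ← hc] at hVv
    have : a + c = a + 1 := by exact_mod_cast hVv
    rw [← hc]
    exact_mod_cast (by omega : c = 1)
  have hpos := IsEffective.ordAt_pos (IsEffective.pullbackAvoiding (g := V.ι) hD hgen) hvi
    (IsEffective.not_isUnitAt_pullbackAvoiding (g := V.ι) hD hgen ⟨i, hmem⟩ hvi hu) hcoh
  omega

/-- **(L2) Every closed point of `|γ| ∩ |D|` has coefficient `≥ 1` in `D · γ`**, for `D` effective and
`γ` an effective `1`-cycle none of whose components lies in `|D|`: all summands `γ(z) · (D · [V_z])(x)`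
are `≥ 0` (★ `primeInter_nonneg`) and the one through `x` is `≥ 1 · 1` by (L1).
[cite: Fulton1998, Prop. 7.1 (a) (p. 120)] [cite: Fulton1998, Def. 2.3 (p. 33)] -/
theorem one_le_interCycle_apply {D : CartierDivisor X.left} (hD : D.IsEffective)
    {γ : AlgebraicCycle X.left ℤ} (hγ : γ ∈ cyclesOfDim X.left 1) (hγ0 : 0 ≤ γ)
    (hav : ∀ z, γ z ≠ 0 → D.Avoids z) {x : X.left} (hx0 : height x = 0) (hx : ¬ D.Avoids x)
    (hxγ : ∃ z, γ z ≠ 0 ∧ z ⤳ x) : 1 ≤ D.interCycle γ x := by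
  obtain ⟨z₀, hz₀, hz₀x⟩ := hxγ
  have hterm : ∀ z, 0 ≤ γ z * D.primeInter z x := fun z => by
    by_cases hz : γ z = 0
    · rw [hz, zero_mul]
    · exact mul_nonneg (hγ0 z) (primeInter_nonneg hD (hav z hz) x)
  have h1 : 1 ≤ γ z₀ := by
    have h0 : (0 : ℤ) ≤ γ z₀ := by simpa using hγ0 z₀
    omega
  have h2 : 1 ≤ D.primeInter z₀ x :=
    one_le_primeInter hD (hav z₀ hz₀) hz₀x hx (by rw [hγ z₀ hz₀, hx0]; rfl)
  have h12 : 1 ≤ γ z₀ * D.primeInter z₀ x := by nlinarith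
  have hfin := D.finite_support_mul_primeInter γ x
  rw [interCycle_apply, finsum_eq_sum _ hfin]
  refine le_trans h12 (Finset.single_le_sum (f := fun z => γ z * D.primeInter z x) (fun z _ => hterm z) ?_)
  rw [Set.Finite.mem_toFinset, Function.mem_support]
  exact ne_of_gt (lt_of_lt_of_le one_pos h12)

end Local

section Proper

variable [IsProper X.hom]

omit [IsIntegral X.left] in
/-- **A `0`-cycle on a proper `K`-scheme has finite support** (locally finite support, quasi-compact
space: the fibre of `X → Spec K` over the point). [cite: Fulton1998, Definition 1.4 (p. 13)] -/
theorem finite_support_of_isProper (c : AlgebraicCycle X.left ℤ) :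
    (Function.support c).Finite := by
  haveI : Subsingleton ↥(specOver K K).left := inferInstanceAs (Subsingleton (PrimeSpectrum K))
  have h := finite_preimage_singleton_inter_support (toSpecOver X).left c ⊤
  rwa [show (toSpecOver X).left.base ⁻¹' {⊤} = Set.univ from
    Set.eq_univ_of_forall fun x => Subsingleton.elim _ _, Set.univ_inter] at h

/-- **(C1) A curve meets a hypersurface not containing it in at most `deg (D · γ)` points**
([Fulton1998, Example 8.4.2]: «a curve of degree `e` not contained in the hyperplane `H` meets `H` in
at most `e` points»; [Hartshorne1977, I Thm. 7.7]).  For an effective Cartier divisor `D` on an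
integral proper `K`-scheme `X`, an effective `1`-cycle `γ` with no component inside `|D|`, and any set
`S` of closed points of `|γ| ∩ |D|`: `S` is finite and `#S ≤ deg (D · γ)` — indeed
`deg (D · γ) = Σ_x (D · γ)(x) · [κ(x) : K]` (★ `ChowGroup.degree_mk_eq_finsum`) with every term `≥ 0`
and the terms over `S` `≥ 1` by (L2). [cite: Fulton1998, Example 8.4.2 (p. 146)]
[cite: Hartshorne1977, I Thm. 7.7 (p. 53)] -/
theorem finite_and_ncard_le_degree_interCycle {D : CartierDivisor X.left}
    (hD : D.IsEffective) {γ : AlgebraicCycle X.left ℤ} (hγ : γ ∈ cyclesOfDim X.left 1) (hγ0 : 0 ≤ γ)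
    (hav : ∀ z, γ z ≠ 0 → D.Avoids z) (S : Set X.left)
    (hS : ∀ x ∈ S, height x = 0 ∧ ¬ D.Avoids x ∧ ∃ z, γ z ≠ 0 ∧ z ⤳ x) :
    S.Finite ∧ (S.ncard : ℤ) ≤
      ChowGroup.degree X (ChowGroup.mk X.left 0 ⟨D.interCycle γ, D.interCycle_mem_cyclesOfDim hγ⟩) := by
  set c := D.interCycle γ with hc
  have hcS : ∀ x ∈ S, 1 ≤ c x := fun x hxS =>
    one_le_interCycle_apply hD hγ hγ0 hav (hS x hxS).1 (hS x hxS).2.1 (hS x hxS).2.2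
  have hfin : (Function.support c).Finite := finite_support_of_isProper c
  have hSfin : S.Finite := hfin.subset fun x hxS => by
    rw [Function.mem_support]
    exact ne_of_gt (lt_of_lt_of_le one_pos (hcS x hxS))
  refine ⟨hSfin, ?_⟩
  -- every term of the degree sum is `≥ 0`, those over `S` are `≥ 1`
  have hterm : ∀ x, 0 ≤ c x * ((toSpecOver X).left.residueDegree x : ℤ) := fun x =>
    mul_nonneg (interCycle_nonneg hD hγ0 hav x) (by positivity)
  have htermS : ∀ x ∈ S, 1 ≤ c x * ((toSpecOver X).left.residueDegree x : ℤ) := fun x hxS => by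
    have h1 := hcS x hxS
    have h2 : 1 ≤ ((toSpecOver X).left.residueDegree x : ℤ) := by
      have := residueDegree_toSpecOver_ne_zero (C := X) (hS x hxS).1
      omega
    nlinarith
  have hfin' : (Function.support fun x => c x * ((toSpecOver X).left.residueDegree x : ℤ)).Finite :=
    hfin.subset (Function.support_mul_subset_left _ _)
  rw [ChowGroup.degree_mk_eq_finsum, finsum_eq_sum _ hfin']
  calc (S.ncard : ℤ) = ∑ x ∈ hSfin.toFinset, (1 : ℤ) := by
        simp only [Finset.sum_const, nsmul_eq_mul, mul_one, Set.ncard_eq_toFinset_card S hSfin]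
    _ ≤ ∑ x ∈ hSfin.toFinset, c x * ((toSpecOver X).left.residueDegree x : ℤ) :=
        Finset.sum_le_sum fun x hx => htermS x ((Set.Finite.mem_toFinset hSfin).mp hx)
    _ ≤ ∑ x ∈ hfin'.toFinset, c x * ((toSpecOver X).left.residueDegree x : ℤ) := by
        refine Finset.sum_le_sum_of_subset_of_nonneg (fun x hx => ?_) fun x _ _ => hterm x
        rw [Set.Finite.mem_toFinset] at hx ⊢
        rw [Function.mem_support]
        exact ne_of_gt (lt_of_lt_of_le one_pos (htermS x hx))

/-- **(C1), `Finset` form**: `s.card ≤ deg (D · γ)` for a finite set `s` of closed points of `|γ| ∩ |D|`.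
[cite: Fulton1998, Example 8.4.2 (p. 146)] [cite: Hartshorne1977, I Thm. 7.7 (p. 53)] -/
theorem card_le_degree_interCycle {D : CartierDivisor X.left} (hD : D.IsEffective)
    {γ : AlgebraicCycle X.left ℤ} (hγ : γ ∈ cyclesOfDim X.left 1) (hγ0 : 0 ≤ γ)
    (hav : ∀ z, γ z ≠ 0 → D.Avoids z) (s : Finset X.left)
    (hs : ∀ x ∈ s, height x = 0 ∧ ¬ D.Avoids x ∧ ∃ z, γ z ≠ 0 ∧ z ⤳ x) :
    (s.card : ℤ) ≤ ChowGroup.degree X (ChowGroup.mk X.left 0 ⟨D.interCycle γ, D.interCycle_mem_cyclesOfDim hγ⟩) := by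
  have h := (finite_and_ncard_le_degree_interCycle hD hγ hγ0 hav (s : Set X.left) fun x hx => hs x hx).2
  rwa [Set.ncard_coe_finset] at h

end Proper

end CartierDivisor

end Literature.AlgebraicGeometry.Motives

end
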